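import Literature.Computability.AlgebraicComplexity.BorderApolarityCandidates
import HarnessLib

/-!
# Border apolarity: relabeling the coordinates of a candidate

Topic `Literature/Computability/AlgebraicComplexity`. A product relabeling `(f × g)` of the
coordinates `ι × κ` of a candidate `E ≤ K^{ι × κ}` (`f`, `g` bijections) transports the
`(210)`- and `(120)`-test spaces of `BorderApolarityCandidates.lean` injectively, so the test
dimensions do not drop:

* `BorderApolarity.finrank_testI_le_relabel`, `BorderApolarity.finrank_testK_le_relabel`.

Used to move the `(011)`- and `(101)`-members of a candidate triple of `⟨3,3,3⟩` into the
coordinates of the `(110)`-member (`BorderRankMatMulThreeTransport.lean`).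

## References

* A. Conner, A. Harper, J. M. Landsberg, *New lower bounds for matrix multiplication and `det₃`*,
  Forum Math. Pi 11 (2023) e17, arXiv:1911.07981 — §2.4, §3. [ConnerHarperLandsberg2023]
-/

noncomputable section

namespace Literature.Computability.AlgebraicComplexity

namespace BorderApolarity

open TensorApolarity

universe u

variable {K : Type u} [Field K]
variable {ι κ ι' κ' : Type}

/-- The relabeled `(210)`-test space maps into the `(210)`-test space of the relabeled candidate.
[cite: ConnerHarperLandsberg2023, §2.4] -/
theorem map_testI_le_relabel (f : ι' → ι) (g : κ' → κ) (E : Submodule K (ι × κ → K)) :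
    (testI E).map (LinearMap.funLeft K K fun s : ι' × ι' × κ' => (f s.1, f s.2.1, g s.2.2)) ≤
      testI (E.map (LinearMap.funLeft K K (Prod.map f g))) := by
  rintro _ ⟨y, ⟨hys, hyE⟩, rfl⟩
  refine ⟨fun a a' b => ?_, mem_slicesI.2 fun a₀ => ?_⟩
  · simp only [LinearMap.funLeft_apply]
    exact (mem_symA K).1 hys (f a) (f a') (g b)
  · refine ⟨sliceI (f a₀) y, mem_slicesI.1 hyE (f a₀), ?_⟩
    funext ab
    simp [LinearMap.funLeft_apply]

/-- The relabeled `(120)`-test space maps into the `(120)`-test space of the relabeled candidate.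
[cite: ConnerHarperLandsberg2023, §2.4] -/
theorem map_testK_le_relabel (f : ι' → ι) (g : κ' → κ) (E : Submodule K (ι × κ → K)) :
    (testK E).map (LinearMap.funLeft K K fun s : ι' × κ' × κ' => (f s.1, g s.2.1, g s.2.2)) ≤
      testK (E.map (LinearMap.funLeft K K (Prod.map f g))) := by
  rintro _ ⟨z, ⟨hzs, hzE⟩, rfl⟩
  refine ⟨fun a b b' => ?_, mem_slicesK.2 fun b₁ => ?_⟩
  · simp only [LinearMap.funLeft_apply]
    exact (mem_symB K).1 hzs (f a) (g b) (g b')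
  · refine ⟨sliceK (g b₁) z, mem_slicesK.1 hzE (g b₁), ?_⟩
    funext ab
    simp [LinearMap.funLeft_apply]

/-- **The `(210)`-test dimension does not drop under a surjective product relabeling.**
[cite: ConnerHarperLandsberg2023, §2.4] -/
theorem finrank_testI_le_relabel [Fintype ι] [Fintype κ] [Fintype ι'] [Fintype κ'] {f : ι' → ι} {g : κ' → κ} (hf : Function.Surjective f)
    (hg : Function.Surjective g) (E : Submodule K (ι × κ → K)) :
    Module.finrank K (testI E) ≤
      Module.finrank K (testI (E.map (LinearMap.funLeft K K (Prod.map f g)))) := by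
  have hs : Function.Surjective fun s : ι' × ι' × κ' => (f s.1, f s.2.1, g s.2.2) := by
    rintro ⟨a, a', b⟩
    obtain ⟨x, rfl⟩ := hf a; obtain ⟨x', rfl⟩ := hf a'; obtain ⟨y, rfl⟩ := hg b
    exact ⟨(x, x', y), rfl⟩
  have hinj := LinearMap.funLeft_injective_of_surjective K K _ hs
  calc Module.finrank K (testI E)
      = Module.finrank K ((testI E).map (LinearMap.funLeft K K
          fun s : ι' × ι' × κ' => (f s.1, f s.2.1, g s.2.2))) :=
        (LinearEquiv.finrank_eq (Submodule.equivMapOfInjective _ hinj _)).symm.symm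
    _ ≤ _ := Submodule.finrank_mono (map_testI_le_relabel f g E)

/-- **The `(120)`-test dimension does not drop under a surjective product relabeling.**
[cite: ConnerHarperLandsberg2023, §2.4] -/
theorem finrank_testK_le_relabel [Fintype ι] [Fintype κ] [Fintype ι'] [Fintype κ'] {f : ι' → ι} {g : κ' → κ} (hf : Function.Surjective f)
    (hg : Function.Surjective g) (E : Submodule K (ι × κ → K)) :
    Module.finrank K (testK E) ≤
      Module.finrank K (testK (E.map (LinearMap.funLeft K K (Prod.map f g)))) := by
  have hs : Function.Surjective fun s : ι' × κ' × κ' => (f s.1, g s.2.1, g s.2.2) := by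
    rintro ⟨a, b, b'⟩
    obtain ⟨x, rfl⟩ := hf a; obtain ⟨y, rfl⟩ := hg b; obtain ⟨y', rfl⟩ := hg b'
    exact ⟨(x, y, y'), rfl⟩
  have hinj := LinearMap.funLeft_injective_of_surjective K K _ hs
  calc Module.finrank K (testK E)
      = Module.finrank K ((testK E).map (LinearMap.funLeft K K
          fun s : ι' × κ' × κ' => (f s.1, g s.2.1, g s.2.2))) :=
        (LinearEquiv.finrank_eq (Submodule.equivMapOfInjective _ hinj _)).symm.symm
    _ ≤ _ := Submodule.finrank_mono (map_testK_le_relabel f g E)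

end BorderApolarity

end Literature.Computability.AlgebraicComplexity
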